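import Summits.KontsevichZagierPeriods.KontsevichZagierPeriods.Theorems.UnfoldedStokesStokesGenerationStubGermToOanAuxSeries
import Mathlib.Algebra.Order.Ring.Pow

/-!
# `StokesGeneration` (stmt-KontsevichZagierPeriods-3586), line `Sketch`, stub `stub_spanToReps` — part 3b:
the type-(a) operator of `ℂ[[z₀, z₁, …]]` evaluated on the closed unit cube

Support file for the registered stub `stub_spanToReps` (dictionary, folding half) of the crux
`StokesGeneration` (route UnfoldedStokes, line `Sketch` = card cube-type-a-generation), on top of
`Literature/NumberTheory/Transcendental/AyoubPeriodSeries.lean` (`AyoubRel.CSeries = ℂ[[z₀, z₁, …]]`,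
`AyoubRel.pdz i = ∂/∂zᵢ`, `AyoubRel.restrC i c = (·)|_{zᵢ = c}`, `AyoubRel.DependsOnlyOnLT`).

For `K ∈ ℂ[[z₀, z₁, …]]` depending only on `z₀, …, z_{M-1}`, with coefficients `κ(a)` re-indexed by
`a : Fin M →₀ ℕ`, evaluated at the point of `ℂ^ℕ` attached to `x ∈ ℝᴹ` (coordinates `x`, then `0`):
the value of `K` at `x` is `Σₐ κ(a) xᵃ` (`tsum_coeff_mul_prod_pow_eq_tsum_fin`), that of `∂K/∂z_l` is
the termwise partial derivative `Σₐ κ(a) a_l x_l^{a_l-1} ∏_{j≠l} xⱼ^{aⱼ}` (`tsum_coeff_pdz_eq`), that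
of `K|_{z_l=c}` at `x ∈ [-1,1]ᴹ` (`|c| ≤ 1`) is `Σₐ κ(a) (x|_{x_l=c})ᵃ` (`tsum_coeff_restrC_eq`; Fubini),
and real parts pass through these sums (`re_tsum_monomial`, `re_tsum_pdzMonomial`). The coefficient
facts of part 3a needed here are repeated privately (no dependence on that module). This is the
evaluation bookkeeping of the folding half of the dictionary between Ayoub's series `𝒪_{ℚ̄-alg}(𝔻̄^∞)`
and real functions near the closed unit cube (J. Ayoub, EMS Newsl. 91 (2014) §2.2, Def. 10, Rem. 13).
No definition is introduced.
-/

noncomputable section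

-- `Summit.KontsevichZagierPeriods.KontsevichZagierPeriods.…` is the tree's mandated layout (single-conjunct summit).
set_option linter.dupNamespace false

namespace Summit.KontsevichZagierPeriods.KontsevichZagierPeriods.StokesGenerationLine

open Finsupp MvPowerSeries
open Literature.NumberTheory.Transcendental
open Literature.NumberTheory.Transcendental.AyoubRel

/-! ## Coefficient facts (= part 3a, repeated privately) -/

section Coeff

/-- `coeff_a (∂ᵢ F) = (aᵢ + 1) coeff_{a + eᵢ} F`. [cite: AyoubRelKZRevisited, Théorème 1.1 (a)] -/
private theorem coeff_pdz_loc (i : ℕ) (F : CSeries) (a : ℕ →₀ ℕ) :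
    coeff a (pdz i F) = ((a i : ℂ) + 1) * coeff (a + single i 1) F := rfl

/-- `coeff_a (F|_{zᵢ=c}) = [aᵢ = 0] Σₙ coeff_{a + n eᵢ} F cⁿ`. [cite: AyoubRelKZRevisited, Théorème 1.1 (a)] -/
private theorem coeff_restrC_loc (i : ℕ) (c : ℂ) (F : CSeries) (a : ℕ →₀ ℕ) :
    coeff a (restrC i c F) = if a i = 0 then ∑' n : ℕ, coeff (a + single i n) F * c ^ n else 0 :=
  rfl

variable {F : CSeries} {m : ℕ}

/-- `∂ᵢ` does not introduce variables. [folklore] -/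
private theorem dependsOnlyOnLT_pdz_loc (i : ℕ) (h : DependsOnlyOnLT F m) :
    DependsOnlyOnLT (pdz i F) m := by
  rintro a ⟨i', hi', hai'⟩
  rw [coeff_pdz_loc, h (a + single i 1) ⟨i', hi', fun h0 => hai' ?_⟩, mul_zero]
  rw [Finsupp.add_apply] at h0
  exact Nat.eq_zero_of_add_eq_zero_right h0

/-- `(·)|_{zᵢ=c}` does not introduce variables. [folklore] -/
private theorem dependsOnlyOnLT_restrC_loc (i : ℕ) (c : ℂ) (h : DependsOnlyOnLT F m) :
    DependsOnlyOnLT (restrC i c F) m := by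
  rintro a ⟨i', hi', hai'⟩
  rw [coeff_restrC_loc]
  split_ifs with h0
  · have hn : ∀ n : ℕ, coeff (a + single i n) F * c ^ n = 0 := fun n => by
      rw [h (a + single i n) ⟨i', hi', fun h1 => hai' ?_⟩, zero_mul]
      rw [Finsupp.add_apply] at h1
      exact Nat.eq_zero_of_add_eq_zero_right h1
    simp only [hn, tsum_zero]
  · rfl

/-- `n ≤ (r - 1)⁻¹ rⁿ` for `r > 1` (Bernoulli). [folklore] -/
private theorem nat_le_inv_mul_pow_loc {r : ℝ} (hr : 1 < r) (n : ℕ) :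
    (n : ℝ) ≤ (r - 1)⁻¹ * r ^ n := by
  have h := one_add_mul_le_pow (show (-2 : ℝ) ≤ r - 1 by linarith) n
  rw [add_sub_cancel] at h
  rw [le_inv_mul_iff₀ (sub_pos.mpr hr)]
  nlinarith

end Coeff

/-! ## Re-indexing along `Fin M ↪ ℕ` -/

section Reindex

variable {M : ℕ}

/-- **The value at `x ∈ ℝᴹ` of a series in the variables `z₀, …, z_{M-1}`**, re-indexed by
`Fin M →₀ ℕ`: `Σ_b coeff_b K · pt(x)ᵇ = Σₐ κ(a) ∏ⱼ xⱼ^{aⱼ}`. [folklore] -/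
theorem tsum_coeff_mul_prod_pow_eq_tsum_fin {S : CSeries} (hS : DependsOnlyOnLT S M)
    (x : Fin M → ℝ) :
    ∑' b : ℕ →₀ ℕ, coeff b S *
        b.prod (fun i e => (fun i : ℕ => if hi : i < M then ((x ⟨i, hi⟩ : ℝ) : ℂ) else 0) i ^ e) =
      ∑' a : Fin M →₀ ℕ, coeff (Finsupp.embDomain Fin.valEmbedding a) S *
        ∏ j, ((x j : ℝ) : ℂ) ^ (a j) := by
  have hinj := Finsupp.embDomain_injective (M := ℕ) (Fin.valEmbedding (n := M))
  have hsupp : Function.support (fun b : ℕ →₀ ℕ => coeff b S *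
      b.prod (fun i e => (fun i : ℕ => if hi : i < M then ((x ⟨i, hi⟩ : ℝ) : ℂ) else 0) i ^ e)) ⊆
      Set.range (Finsupp.embDomain (M := ℕ) (Fin.valEmbedding (n := M))) := by
    intro b hb
    by_contra hb'
    apply hb
    show coeff b S * _ = 0
    rw [hS b (exists_of_not_mem_range_embDomain hb'), zero_mul]
  calc ∑' b : ℕ →₀ ℕ, coeff b S *
        b.prod (fun i e => (fun i : ℕ => if hi : i < M then ((x ⟨i, hi⟩ : ℝ) : ℂ) else 0) i ^ e)
      = ∑' a : Fin M →₀ ℕ, coeff (Finsupp.embDomain Fin.valEmbedding a) S *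
          (Finsupp.embDomain Fin.valEmbedding a).prod
            (fun i e => (fun i : ℕ => if hi : i < M then ((x ⟨i, hi⟩ : ℝ) : ℂ) else 0) i ^ e) :=
        (hinj.tsum_eq hsupp).symm
    _ = _ := tsum_congr fun a => by rw [prod_pow_embDomain_cubePt]

/-- Pushing forward `a + n e_l` along `Fin M ↪ ℕ`. [folklore] -/
theorem embDomain_add_single (a : Fin M →₀ ℕ) (l : Fin M) (n : ℕ) :
    Finsupp.embDomain Fin.valEmbedding (a + single l n) =
      Finsupp.embDomain Fin.valEmbedding a + single (l : ℕ) n := by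
  rw [Finsupp.embDomain_add, Finsupp.embDomain_single]
  rfl

/-- The `l`-th exponent of a pushed-forward multi-index. [folklore] -/
theorem embDomain_apply_val (a : Fin M →₀ ℕ) (l : Fin M) :
    Finsupp.embDomain Fin.valEmbedding a (l : ℕ) = a l :=
  Finsupp.embDomain_apply_self Fin.valEmbedding a l

/-- Re-indexed coefficients of `∂_l K`. [cite: AyoubRelKZRevisited, Théorème 1.1 (a)] -/
theorem coeff_embDomain_pdz (S : CSeries) (a : Fin M →₀ ℕ) (l : Fin M) :
    coeff (Finsupp.embDomain Fin.valEmbedding a) (pdz (l : ℕ) S) =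
      ((a l : ℂ) + 1) * coeff (Finsupp.embDomain Fin.valEmbedding (a + single l 1)) S := by
  rw [coeff_pdz_loc, embDomain_add_single, embDomain_apply_val]

/-- Re-indexed coefficients of `K|_{z_l = c}`. [cite: AyoubRelKZRevisited, Théorème 1.1 (a)] -/
theorem coeff_embDomain_restrC (S : CSeries) (c : ℂ) (a : Fin M →₀ ℕ) (l : Fin M) :
    coeff (Finsupp.embDomain Fin.valEmbedding a) (restrC (l : ℕ) c S) =
      if a l = 0 then ∑' n : ℕ, coeff (Finsupp.embDomain Fin.valEmbedding (a + single l n)) S * c ^ n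
      else 0 := by
  rw [coeff_restrC_loc, embDomain_apply_val]
  simp only [embDomain_add_single]

end Reindex

/-! ## The analytic dictionary on `ℂᴹ`: termwise partials and restrictions -/

section Dictionary

variable {M : ℕ} (κ : (Fin M →₀ ℕ) → ℂ)

/-- A monomial at a point of the closed unit polydisc of `ℂᴹ` has modulus `≤ 1`. [folklore] -/
theorem norm_prod_pow_le_one_fin {y : Fin M → ℂ} (hy : ∀ j, ‖y j‖ ≤ 1) (s : Finset (Fin M))
    (b : Fin M →₀ ℕ) : ‖∏ j ∈ s, y j ^ b j‖ ≤ 1 := by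
  rw [norm_prod]
  refine Finset.prod_le_one (fun j _ => norm_nonneg _) fun j _ => ?_
  rw [norm_pow]
  exact pow_le_one₀ (norm_nonneg _) (hy j)

/-- The family `κ(a) yᵃ` is absolutely summable on the closed unit polydisc. [folklore] -/
theorem summable_mul_monomial (hκ : Summable fun a => ‖κ a‖) {y : Fin M → ℂ}
    (hy : ∀ j, ‖y j‖ ≤ 1) : Summable fun a : Fin M →₀ ℕ => κ a * ∏ j, y j ^ a j :=
  Summable.of_norm_bounded hκ fun a => by
    rw [norm_mul]
    exact mul_le_of_le_one_right (norm_nonneg _) (norm_prod_pow_le_one_fin hy _ a)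

/-- The family of termwise partial derivatives `κ(b) b_l y_l^{b_l-1} ∏_{j≠l} yⱼ^{bⱼ}` is summable on
the closed unit polydisc when `Σ_b ‖κ b‖ r^{|b|} < ∞`, `r > 1`. [folklore] -/
theorem summable_pdzFamily {r : ℝ} (hr : 1 < r) (hκ : Summable fun b => ‖κ b‖ * r ^ b.degree)
    {y : Fin M → ℂ} (hy : ∀ j, ‖y j‖ ≤ 1) (l : Fin M) :
    Summable fun b : Fin M →₀ ℕ =>
      κ b * ((∏ j ∈ Finset.univ.erase l, y j ^ b j) * ((b l : ℂ) * y l ^ (b l - 1))) := by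
  refine Summable.of_norm_bounded (hκ.mul_left (r - 1)⁻¹) fun b => ?_
  rw [norm_mul, norm_mul, norm_mul]
  have h1 : ‖∏ j ∈ Finset.univ.erase l, y j ^ b j‖ ≤ 1 := norm_prod_pow_le_one_fin hy _ b
  have h2 : ‖y l ^ (b l - 1)‖ ≤ 1 := by
    rw [norm_pow]
    exact pow_le_one₀ (norm_nonneg _) (hy l)
  have h3 : ‖(b l : ℂ)‖ = (b l : ℝ) := Complex.norm_natCast _
  have h4 : (b l : ℝ) ≤ (r - 1)⁻¹ * r ^ b.degree :=
    le_trans (by exact_mod_cast le_degree l b) (nat_le_inv_mul_pow_loc hr _)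
  have hr0 : 0 ≤ (r - 1)⁻¹ * r ^ b.degree := le_trans (Nat.cast_nonneg _) h4
  calc ‖κ b‖ * (‖∏ j ∈ Finset.univ.erase l, y j ^ b j‖ * (‖(b l : ℂ)‖ * ‖y l ^ (b l - 1)‖))
      ≤ ‖κ b‖ * (1 * ((r - 1)⁻¹ * r ^ b.degree * 1)) := by
        rw [h3]
        refine mul_le_mul_of_nonneg_left ?_ (norm_nonneg _)
        exact mul_le_mul h1 (mul_le_mul h4 h2 (norm_nonneg _) hr0) (by positivity) zero_le_one
    _ = (r - 1)⁻¹ * (‖κ b‖ * r ^ b.degree) := by ring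

/-- **Termwise partial derivative**: re-indexing `b = a + e_l`,
`Σₐ (a_l + 1) κ(a + e_l) yᵃ = Σ_b κ(b) b_l y_l^{b_l - 1} ∏_{j ≠ l} yⱼ^{bⱼ}` (as sums over the
injective re-indexing; no convergence needed). [cite: Ayoub2014, Rem. 13] -/
theorem tsum_pdz_fin (y : Fin M → ℂ) (l : Fin M) :
    ∑' a : Fin M →₀ ℕ, ((a l : ℂ) + 1) * κ (a + single l 1) * ∏ j, y j ^ a j =
      ∑' b : Fin M →₀ ℕ,
        κ b * ((∏ j ∈ Finset.univ.erase l, y j ^ b j) * ((b l : ℂ) * y l ^ (b l - 1))) := by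
  set G : (Fin M →₀ ℕ) → ℂ := fun b =>
    κ b * ((∏ j ∈ Finset.univ.erase l, y j ^ b j) * ((b l : ℂ) * y l ^ (b l - 1))) with hG
  have hinj : Function.Injective fun a : Fin M →₀ ℕ => a + single l 1 := add_left_injective _
  have hcomp : ∀ a : Fin M →₀ ℕ,
      G (a + single l 1) = ((a l : ℂ) + 1) * κ (a + single l 1) * ∏ j, y j ^ a j := by
    intro a
    have he : ∏ j ∈ Finset.univ.erase l, y j ^ (a + single l 1 : Fin M →₀ ℕ) j =
        ∏ j ∈ Finset.univ.erase l, y j ^ a j :=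
      Finset.prod_congr rfl fun j hj => by
        rw [Finsupp.add_apply, single_eq_of_ne (Finset.ne_of_mem_erase hj), add_zero]
    rw [hG]
    simp only
    rw [he, Finsupp.add_apply, single_eq_same, Nat.add_sub_cancel, Nat.cast_add, Nat.cast_one,
      ← Finset.mul_prod_erase Finset.univ (fun j => y j ^ a j) (Finset.mem_univ l)]
    ring
  have hsupp : Function.support G ⊆ Set.range fun a : Fin M →₀ ℕ => a + single l 1 := by
    intro b hb
    have hbl : b l ≠ 0 := by
      intro h0
      apply hb
      simp [hG, h0]
    exact ⟨b - single l 1,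
      tsub_add_cancel_of_le (single_le_iff.mpr (Nat.one_le_iff_ne_zero.mpr hbl))⟩
  calc ∑' a : Fin M →₀ ℕ, ((a l : ℂ) + 1) * κ (a + single l 1) * ∏ j, y j ^ a j
      = ∑' a : Fin M →₀ ℕ, G (a + single l 1) := tsum_congr fun a => (hcomp a).symm
    _ = ∑' b, G b := hinj.tsum_eq hsupp

/-- **Restriction to `z_l = c`**: `Σₐ [a_l = 0] (Σₙ κ(a + n e_l) cⁿ) yᵃ = Σ_b κ(b) (y|_{y_l = c})ᵇ` on
the closed unit polydisc, `|c| ≤ 1` (Fubini over `b ↔ (b ∖ l, b_l)`). [cite: Ayoub2014, Rem. 13] -/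
theorem tsum_restrC_fin (hκ : Summable fun b => ‖κ b‖) {y : Fin M → ℂ} (hy : ∀ j, ‖y j‖ ≤ 1)
    (l : Fin M) {c : ℂ} (hc : ‖c‖ ≤ 1) :
    ∑' a : Fin M →₀ ℕ, (if a l = 0 then ∑' n : ℕ, κ (a + single l n) * c ^ n else 0) *
        ∏ j, y j ^ a j =
      ∑' b : Fin M →₀ ℕ, κ b * ∏ j, Function.update y l c j ^ b j := by
  classical
  -- monomial identities
  have m1 : ∀ b : Fin M →₀ ℕ, ∏ j, Function.update y l c j ^ b j =
      c ^ b l * ∏ j ∈ Finset.univ.erase l, y j ^ b j := by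
    intro b
    rw [← Finset.mul_prod_erase Finset.univ _ (Finset.mem_univ l), Function.update_self]
    congr 1
    exact Finset.prod_congr rfl fun j hj => by
      rw [Function.update_of_ne (Finset.ne_of_mem_erase hj)]
  have m2 : ∀ b : Fin M →₀ ℕ, ∏ j, y j ^ (b.erase l) j = ∏ j ∈ Finset.univ.erase l, y j ^ b j := by
    intro b
    rw [← Finset.mul_prod_erase Finset.univ _ (Finset.mem_univ l), erase_same, pow_zero, one_mul]
    exact Finset.prod_congr rfl fun j hj => by rw [erase_ne (Finset.ne_of_mem_erase hj)]
  set h : (Fin M →₀ ℕ) × ℕ → ℂ := fun p =>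
    if p.1 l = 0 then κ (p.1 + single l p.2) * c ^ p.2 * ∏ j, y j ^ p.1 j else 0 with hh
  set ψ : (Fin M →₀ ℕ) → (Fin M →₀ ℕ) × ℕ := fun b => (b.erase l, b l) with hψ
  have hψinj : Function.Injective ψ := by
    intro b b' e
    simp only [hψ, Prod.mk.injEq] at e
    rw [← erase_add_single l b, ← erase_add_single l b', e.1, e.2]
  have hψcomp : ∀ b, h (ψ b) = κ b * ∏ j, Function.update y l c j ^ b j := by
    intro b
    simp only [hh, hψ, erase_same, if_true, erase_add_single]
    rw [m1, m2]
    ring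
  have hrange : ∀ p, p ∉ Set.range ψ → h p = 0 := by
    rintro ⟨a, n⟩ hp
    simp only [hh]
    split_ifs with ha
    · refine absurd ⟨a + single l n, ?_⟩ hp
      simp only [hψ, Prod.mk.injEq, Finsupp.add_apply, single_eq_same, ha, zero_add, and_true]
      rw [Finsupp.erase_add, erase_single, add_zero]
      exact erase_of_notMem_support (by simpa using ha)
    · rfl
  have hhs : Summable h := by
    refine (hψinj.summable_iff hrange).mp ?_
    have heq : h ∘ ψ = fun b => κ b * ∏ j, Function.update y l c j ^ b j := funext hψcomp
    rw [heq]
    refine summable_mul_monomial κ hκ fun j => ?_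
    rcases eq_or_ne j l with rfl | hj
    · rwa [Function.update_self]
    · rw [Function.update_of_ne hj]
      exact hy j
  -- the inner sums
  have hterm : ∀ a : Fin M →₀ ℕ,
      (if a l = 0 then ∑' n : ℕ, κ (a + single l n) * c ^ n else 0) * ∏ j, y j ^ a j =
        ∑' n : ℕ, h (a, n) := by
    intro a
    split_ifs with ha
    · rw [← tsum_mul_right]
      exact tsum_congr fun n => by simp only [hh, if_pos ha]
    · simp only [hh, if_neg ha, tsum_zero, zero_mul]
  calc ∑' a : Fin M →₀ ℕ, (if a l = 0 then ∑' n : ℕ, κ (a + single l n) * c ^ n else 0) *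
        ∏ j, y j ^ a j
      = ∑' a : Fin M →₀ ℕ, ∑' n : ℕ, h (a, n) := tsum_congr hterm
    _ = ∑' p, h p := hhs.tsum_prod.symm
    _ = ∑' b, h (ψ b) := (hψinj.tsum_eq fun p hp => by
        by_contra hp'
        exact hp (hrange p hp')).symm
    _ = _ := tsum_congr hψcomp

end Dictionary

/-! ## Evaluating `∂_l K` and `K|_{z_l = c}` at real points; real parts -/

section RealPoints

variable {M : ℕ}

/-- **`∂_l K` evaluated at `x ∈ ℝᴹ` is the termwise partial derivative of the evaluated
series** (re-indexing). [cite: Ayoub2014, Rem. 13] -/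
theorem tsum_coeff_pdz_eq {K : CSeries} (hK : DependsOnlyOnLT K M) (x : Fin M → ℝ) (l : Fin M) :
    ∑' b : ℕ →₀ ℕ, coeff b (pdz (l : ℕ) K) *
        b.prod (fun i e => (fun i : ℕ => if hi : i < M then ((x ⟨i, hi⟩ : ℝ) : ℂ) else 0) i ^ e) =
      ∑' a : Fin M →₀ ℕ, coeff (Finsupp.embDomain Fin.valEmbedding a) K *
        ((∏ j ∈ Finset.univ.erase l, ((x j : ℝ) : ℂ) ^ a j) *
          ((a l : ℂ) * ((x l : ℝ) : ℂ) ^ (a l - 1))) := by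
  rw [tsum_coeff_mul_prod_pow_eq_tsum_fin (dependsOnlyOnLT_pdz_loc _ hK) x]
  simp only [coeff_embDomain_pdz]
  exact tsum_pdz_fin (fun a => coeff (Finsupp.embDomain Fin.valEmbedding a) K)
    (fun j => ((x j : ℝ) : ℂ)) l

/-- **`K|_{z_l = c}` evaluated at `x ∈ [-1, 1]ᴹ` is the evaluated series at `x` with `x_l`
replaced by `c`** (`|c| ≤ 1` real). [cite: Ayoub2014, Rem. 13] -/
theorem tsum_coeff_restrC_eq {K : CSeries} (hK : DependsOnlyOnLT K M)
    (hs : Summable fun b : ℕ →₀ ℕ => ‖coeff b K‖)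
    (x : Fin M → ℝ) (hx : ∀ j, |x j| ≤ 1) (l : Fin M) (c : ℝ) (hc : |c| ≤ 1) :
    ∑' b : ℕ →₀ ℕ, coeff b (restrC (l : ℕ) (c : ℂ) K) *
        b.prod (fun i e => (fun i : ℕ => if hi : i < M then ((x ⟨i, hi⟩ : ℝ) : ℂ) else 0) i ^ e) =
      ∑' a : Fin M →₀ ℕ, coeff (Finsupp.embDomain Fin.valEmbedding a) K *
        ∏ j, ((Function.update x l c j : ℝ) : ℂ) ^ a j := by
  have hy : ∀ j, ‖((x j : ℝ) : ℂ)‖ ≤ 1 := fun j => by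
    rw [Complex.norm_real, Real.norm_eq_abs]; exact hx j
  have hκ : Summable fun a : Fin M →₀ ℕ => ‖coeff (Finsupp.embDomain Fin.valEmbedding a) K‖ :=
    hs.comp_injective (Finsupp.embDomain_injective (M := ℕ) (Fin.valEmbedding (n := M)))
  have hc' : ‖(c : ℂ)‖ ≤ 1 := by rwa [Complex.norm_real, Real.norm_eq_abs]
  rw [tsum_coeff_mul_prod_pow_eq_tsum_fin (dependsOnlyOnLT_restrC_loc _ _ hK) x]
  simp only [coeff_embDomain_restrC]
  rw [tsum_restrC_fin _ hκ hy l hc']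
  refine tsum_congr fun a => ?_
  congr 1
  refine Finset.prod_congr rfl fun j _ => ?_
  rw [Function.apply_update (fun _ => Complex.ofReal) x l c j]

/-- Real parts of sums `Σₐ κ(a) mₐ` with real `mₐ`. [folklore] -/
theorem re_tsum_mul_ofReal {ι : Type*} {κ : ι → ℂ} {m : ι → ℝ}
    (h : Summable fun a => κ a * (m a : ℂ)) :
    (∑' a, κ a * (m a : ℂ)).re = ∑' a, (κ a).re * m a := by
  rw [Complex.re_tsum h]
  exact tsum_congr fun a => by simp [Complex.mul_re]

/-- **Real part of the evaluated series**: `re Σₐ κ(a) xᵃ = Σₐ re(κ a) xᵃ` at real points of the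
closed unit cube. [cite: Ayoub2014, Rem. 13] -/
theorem re_tsum_monomial (κ : (Fin M →₀ ℕ) → ℂ) (hκ : Summable fun a => ‖κ a‖)
    (x : Fin M → ℝ) (hx : ∀ j, |x j| ≤ 1) :
    (∑' a : Fin M →₀ ℕ, κ a * ∏ j, ((x j : ℝ) : ℂ) ^ a j).re =
      ∑' a : Fin M →₀ ℕ, (κ a).re * ∏ j, x j ^ a j := by
  have hy : ∀ j, ‖((x j : ℝ) : ℂ)‖ ≤ 1 := fun j => by
    rw [Complex.norm_real, Real.norm_eq_abs]; exact hx j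
  have heq : (fun a : Fin M →₀ ℕ => κ a * ∏ j, ((x j : ℝ) : ℂ) ^ a j) =
      fun a => κ a * ((∏ j, x j ^ a j : ℝ) : ℂ) := by
    funext a
    push_cast
    rfl
  rw [heq]
  exact re_tsum_mul_ofReal (heq ▸ summable_mul_monomial κ hκ hy)

/-- **Real part of the termwise partial derivative** at real points of the closed unit cube.
[cite: Ayoub2014, Rem. 13] -/
theorem re_tsum_pdzMonomial (κ : (Fin M →₀ ℕ) → ℂ) {r : ℝ} (hr : 1 < r)
    (hκ : Summable fun b => ‖κ b‖ * r ^ b.degree) (x : Fin M → ℝ) (hx : ∀ j, |x j| ≤ 1)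
    (l : Fin M) :
    (∑' a : Fin M →₀ ℕ, κ a * ((∏ j ∈ Finset.univ.erase l, ((x j : ℝ) : ℂ) ^ a j) *
        ((a l : ℂ) * ((x l : ℝ) : ℂ) ^ (a l - 1)))).re =
      ∑' a : Fin M →₀ ℕ, (κ a).re * ((∏ j ∈ Finset.univ.erase l, x j ^ a j) *
        ((a l : ℝ) * x l ^ (a l - 1))) := by
  have hy : ∀ j, ‖((x j : ℝ) : ℂ)‖ ≤ 1 := fun j => by
    rw [Complex.norm_real, Real.norm_eq_abs]; exact hx j
  have heq : (fun a : Fin M →₀ ℕ => κ a * ((∏ j ∈ Finset.univ.erase l, ((x j : ℝ) : ℂ) ^ a j) *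
      ((a l : ℂ) * ((x l : ℝ) : ℂ) ^ (a l - 1)))) =
      fun a => κ a * (((∏ j ∈ Finset.univ.erase l, x j ^ a j) *
        ((a l : ℝ) * x l ^ (a l - 1)) : ℝ) : ℂ) := by
    funext a
    push_cast
    rfl
  rw [heq]
  exact re_tsum_mul_ofReal (heq ▸ summable_pdzFamily κ hr hκ hy l)

end RealPoints

/-! ## Registered form -/

/-- **Registered auxiliary stub** `stub_spanToRepsAuxSeries` (sub-goal of `stub_spanToReps`, crux
stmt-KontsevichZagierPeriods-3586): for `K ∈ ℂ[[z₀, z₁, …]]` in the variables `z₀, …, z_{M-1}` with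
absolutely summable coefficients, at `x ∈ [-1, 1]ᴹ` the derivative `∂_l K` evaluates to the termwise
partial derivative of the evaluated series and the restriction `K|_{z_l = c}` (`|c| ≤ 1`) to the
evaluated series at `x|_{x_l = c}` (= `tsum_coeff_pdz_eq`, `tsum_coeff_restrC_eq`).
[cite: Ayoub2014, Rem. 13] -/
theorem stub_spanToRepsAuxSeries :
    ∀ (M : ℕ) (K : MvPowerSeries ℕ ℂ) (x : Fin M → ℝ) (l : Fin M) (c : ℝ),
      AyoubRel.DependsOnlyOnLT K M →
      Summable (fun b : ℕ →₀ ℕ => ‖MvPowerSeries.coeff b K‖) → (∀ j, |x j| ≤ 1) → |c| ≤ 1 →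
      (∑' b : ℕ →₀ ℕ, MvPowerSeries.coeff b (AyoubRel.pdz (l : ℕ) K) *
          b.prod (fun i e => (fun i : ℕ => if hi : i < M then ((x ⟨i, hi⟩ : ℝ) : ℂ) else 0) i ^ e) =
        ∑' a : Fin M →₀ ℕ, MvPowerSeries.coeff (Finsupp.embDomain Fin.valEmbedding a) K *
          ((∏ j ∈ Finset.univ.erase l, ((x j : ℝ) : ℂ) ^ a j) *
            ((a l : ℂ) * ((x l : ℝ) : ℂ) ^ (a l - 1)))) ∧
      ∑' b : ℕ →₀ ℕ, MvPowerSeries.coeff b (AyoubRel.restrC (l : ℕ) (c : ℂ) K) *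
          b.prod (fun i e => (fun i : ℕ => if hi : i < M then ((x ⟨i, hi⟩ : ℝ) : ℂ) else 0) i ^ e) =
        ∑' a : Fin M →₀ ℕ, MvPowerSeries.coeff (Finsupp.embDomain Fin.valEmbedding a) K *
          ∏ j, ((Function.update x l c j : ℝ) : ℂ) ^ a j :=
  fun _ _ x l c hK hs hx hc => ⟨tsum_coeff_pdz_eq hK x l, tsum_coeff_restrC_eq hK hs x hx l c hc⟩

end Summit.KontsevichZagierPeriods.KontsevichZagierPeriods.StokesGenerationLine
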